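import Literature.AlgebraicGeometry.Motives.HodgeLieDuplicateSummand
import Literature.AlgebraicGeometry.Motives.HodgeLieProductSimpleFactor
import Literature.AlgebraicGeometry.Motives.HodgeStructureWeil
import HarnessLib

/-!
# `Θ`-rigidity survives a duplicate summand: if `𝔥(H')` is `Θ`-rigid and `H ≅ H' ⊕ H₂` with `H₂` already a direct summand of `H'`, then `𝔥(H)` is
# `Θ`-rigid (multiplicities keep rigidity; Moonen–Zarhin §1 / Moonen (1.8): `Hg(X × B) = Hg(X)` for `B` a factor of `X`)

Family `hodge`, layer `Literature/AlgebraicGeometry/Motives`.  THEOREMS ONLY (no definition, no named fact).  Written for the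
cell `pub-hodgecm2` (COR-CM), seat `b27` gen 54 (count-neutral Mumford–Tate-rank ladder, «rigidity modulo the centre», part 7).

SETTING of `Motives/HodgeLieDuplicateSummand`: `H' ≅ H₁ ⊕ H₂` (`ι₁', π₁', ι₂', π₂'`), `H ≅ H' ⊕ H₂` (`ι₀, π₀, ι₃, π₃`), any weight; there:
the restriction `r : X ↦ π₀ X ι₀` is injective on `𝔥(H)` and `dim 𝔥(H) = dim 𝔥(H')`.  HERE: **`rigid_of_duplicate_summand`** — if every
bracket-closed rational `𝔟 ⊆ 𝔥(H')` whose complex span contains a Hodge operator is `𝔥(H')`, the same holds for `H`.  PROOF.  For a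
`Θ`-subalgebra `𝔞 ⊆ 𝔥(H)`, `r(𝔞) ⊆ 𝔥(H')` is bracket-closed (`restrict_mul`) and its complex span contains the Hodge operator `π₀ Θ ι₀` of `H'`
(`restrict_mem_spanC_map`, `restrict_theta_apply`); rigidity of `H'` gives `r(𝔞) = 𝔥(H')`, so `dim 𝔞 ≥ dim 𝔥(H') = dim 𝔥(H)` and `𝔞 = 𝔥(H)`.
No use of the reductive structure: this is the elementary half of «multiplicities do not matter» for rigidity (the ladder had it for the family
`T_IV × curves`, `CorCM/MumfordTateRankTypeIVThreefoldTimesAllCurvesRigid`).  AV reading: `CorCM/MumfordTateRankRigidDuplicateFactor`.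

## References
* [MoonenZarhin1999LowDim] B. Moonen, Yu. G. Zarhin, Math. Ann. 315 (1999), §1 and §3 (3.1) [corpus: paper:arxiv-math_9901113 pp. 2, 6].
  [cite: MoonenZarhin1999LowDim, §1 and §3]
* [Moonen1999MTNotes] B. Moonen, *Notes on Mumford–Tate groups* (1999), (1.8), (1.13). [cite: Moonen1999MTNotes, (1.8) and (1.13)]
-/

noncomputable section

open scoped TensorProduct

namespace Literature.AlgebraicGeometry.Motives

namespace HodgeStructure

universe u

variable {V₁ : Type u} [AddCommGroup V₁] [Module ℚ V₁] [Module.Finite ℚ V₁]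
  {V₂ : Type u} [AddCommGroup V₂] [Module ℚ V₂] [Module.Finite ℚ V₂]
  {V' : Type u} [AddCommGroup V'] [Module ℚ V'] [Module.Finite ℚ V']
  {V : Type u} [AddCommGroup V] [Module ℚ V] [Module.Finite ℚ V] [HodgeTensorFacts.{u, u}] {n : ℤ}
  {H₁ : HodgeStructure V₁ n} {H₂ : HodgeStructure V₂ n} {H' : HodgeStructure V' n} {H : HodgeStructure V n}

section Theta

variable (ι₀ : Hom H' H) (π₀ : Hom H H') (hπι₀ : ∀ v, π₀.toLinearMap (ι₀.toLinearMap v) = v)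

omit [Module.Finite ℚ V'] [Module.Finite ℚ V] [HodgeTensorFacts.{u, u}] in
/-- The restriction `Y ↦ π₀ Y ι₀` maps the complex span of `𝔞` into the complex span of `r(𝔞)`. [cite: MoonenZarhin1999LowDim, §1 and §3] -/
theorem restrict_mem_spanC_map (𝔞 : Submodule ℚ (Module.End ℚ V)) {Y : Module.End ℂ (ℂ ⊗[ℚ] V)}
    (hY : Y ∈ Submodule.span ℂ ((fun X : Module.End ℚ V => X.baseChange ℂ) '' (𝔞 : Set (Module.End ℚ V)))) :
    π₀.toLinearMap.baseChange ℂ ∘ₗ Y ∘ₗ ι₀.toLinearMap.baseChange ℂ ∈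
      Submodule.span ℂ ((fun X : Module.End ℚ V' => X.baseChange ℂ) ''
        ((𝔞.map ((LinearMap.llcomp ℚ V' V V' π₀.toLinearMap).comp (LinearMap.lcomp ℚ V ι₀.toLinearMap)) :
          Submodule ℚ (Module.End ℚ V')) : Set (Module.End ℚ V'))) := by
  induction hY using Submodule.span_induction with
  | mem Z hZ =>
    obtain ⟨X, hX, rfl⟩ := hZ
    refine Submodule.subset_span ⟨π₀.toLinearMap ∘ₗ X ∘ₗ ι₀.toLinearMap, ⟨X, hX, rfl⟩, ?_⟩
    simp only [LinearMap.baseChange_comp]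
  | zero => simp only [LinearMap.zero_comp, LinearMap.comp_zero]; exact Submodule.zero_mem _
  | add Z Z' _ _ hZ hZ' => simp only [LinearMap.add_comp, LinearMap.comp_add]; exact Submodule.add_mem _ hZ hZ'
  | smul c Z _ hZ => simp only [LinearMap.smul_comp, LinearMap.comp_smul]; exact Submodule.smul_mem _ c hZ

omit [Module.Finite ℚ V'] [Module.Finite ℚ V] [HodgeTensorFacts.{u, u}] in
include hπι₀ in
/-- **The restriction `π₀ Θ ι₀` of a Hodge operator of `H` is a Hodge operator of the retract `H'`** (`ι₀` maps pieces to pieces, `π₀ ι₀ = id`).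
[cite: MoonenZarhin1999LowDim, §1 and §3] -/
theorem restrict_theta_apply (Θ : Module.End ℂ (ℂ ⊗[ℚ] V)) (hΘ : ∀ p, ∀ x ∈ H.piece p (n - p), Θ x = ((2 * p - n : ℤ) : ℂ) • x) :
    ∀ p, ∀ x ∈ H'.piece p (n - p), (π₀.toLinearMap.baseChange ℂ ∘ₗ Θ ∘ₗ ι₀.toLinearMap.baseChange ℂ) x = ((2 * p - n : ℤ) : ℂ) • x := by
  have hπιC : ∀ y, π₀.toLinearMap.baseChange ℂ (ι₀.toLinearMap.baseChange ℂ y) = y := fun y => by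
    have h := congrArg (LinearMap.baseChange ℂ) (LinearMap.ext hπι₀ : π₀.toLinearMap ∘ₗ ι₀.toLinearMap = LinearMap.id)
    rw [LinearMap.baseChange_comp, LinearMap.baseChange_id] at h
    exact LinearMap.congr_fun h y
  intro p x hx
  have hιx : ι₀.toLinearMap.baseChange ℂ x ∈ H.piece p (n - p) := Hom.map_piece_le ι₀ p _ ⟨x, hx, rfl⟩
  rw [LinearMap.comp_apply, LinearMap.comp_apply, hΘ p _ hιx, map_smul, hπιC]

end Theta

variable (ι₁' : Hom H₁ H') (π₁' : Hom H' H₁) (ι₂' : Hom H₂ H') (π₂' : Hom H' H₂)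
  (hπι₁' : ∀ v, π₁'.toLinearMap (ι₁'.toLinearMap v) = v) (hπι₂' : ∀ v, π₂'.toLinearMap (ι₂'.toLinearMap v) = v)
  (hsum' : ∀ v, ι₁'.toLinearMap (π₁'.toLinearMap v) + ι₂'.toLinearMap (π₂'.toLinearMap v) = v)
  (ι₀ : Hom H' H) (π₀ : Hom H H') (ι₃ : Hom H₂ H) (π₃ : Hom H H₂)
  (hπι₀ : ∀ v, π₀.toLinearMap (ι₀.toLinearMap v) = v) (hπι₃ : ∀ v, π₃.toLinearMap (ι₃.toLinearMap v) = v)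
  (hsum : ∀ v, ι₀.toLinearMap (π₀.toLinearMap v) + ι₃.toLinearMap (π₃.toLinearMap v) = v)

omit [Module.Finite ℚ V₁] [Module.Finite ℚ V₂] in
include hπι₁' hπι₂' hsum' hπι₀ hπι₃ hsum in
/-- **`Θ`-rigidity survives a duplicate summand**: `H ≅ H' ⊕ H₂` with `H₂` a direct summand of `H'`, and `𝔥(H')` `Θ`-rigid ⟹ `𝔥(H)` `Θ`-rigid
(restriction of a `Θ`-subalgebra of `𝔥(H)` is a `Θ`-subalgebra of `𝔥(H')`, hence everything; `dim 𝔥(H) = dim 𝔥(H')`).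
[cite: MoonenZarhin1999LowDim, §1 and §3] [cite: Moonen1999MTNotes, (1.8) and (1.13)] -/
theorem rigid_of_duplicate_summand
    (hrig' : ∀ 𝔟 : Submodule ℚ (Module.End ℚ V'), 𝔟 ≤ H'.hodgeLie →
      (∀ X ∈ 𝔟, ∀ Y ∈ 𝔟, X * Y - Y * X ∈ 𝔟) →
      (∃ Θ ∈ Submodule.span ℂ ((fun X : Module.End ℚ V' => X.baseChange ℂ) '' (𝔟 : Set (Module.End ℚ V'))),
        ∀ p, ∀ x ∈ H'.piece p (n - p), Θ x = ((2 * p - n : ℤ) : ℂ) • x) → H'.hodgeLie ≤ 𝔟) :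
    ∀ 𝔞 : Submodule ℚ (Module.End ℚ V), 𝔞 ≤ H.hodgeLie →
      (∀ X ∈ 𝔞, ∀ Y ∈ 𝔞, X * Y - Y * X ∈ 𝔞) →
      (∃ Θ ∈ Submodule.span ℂ ((fun X : Module.End ℚ V => X.baseChange ℂ) '' (𝔞 : Set (Module.End ℚ V))),
        ∀ p, ∀ x ∈ H.piece p (n - p), Θ x = ((2 * p - n : ℤ) : ℂ) • x) → H.hodgeLie ≤ 𝔞 := by
  classical
  intro 𝔞 h𝔞 hbr hΘex
  obtain ⟨Θ, hΘ𝔞, hΘ⟩ := hΘex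
  set r := (LinearMap.llcomp ℚ V' V V' π₀.toLinearMap).comp (LinearMap.lcomp ℚ V ι₀.toLinearMap) with hr
  have hr_apply : ∀ X : Module.End ℚ V, r X = π₀.toLinearMap ∘ₗ X ∘ₗ ι₀.toLinearMap := fun X => rfl
  -- `r(𝔞)` is a `Θ`-subalgebra of `𝔥(H')`
  have hle : 𝔞.map r ≤ H'.hodgeLie := by
    rintro _ ⟨X, hX, rfl⟩
    rw [hr_apply]
    exact comp_mem_hodgeLie_of_retract ι₀ π₀ hπι₀ (h𝔞 hX)
  have hbr' : ∀ X ∈ 𝔞.map r, ∀ Y ∈ 𝔞.map r, X * Y - Y * X ∈ 𝔞.map r := by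
    rintro _ ⟨X, hX, rfl⟩ _ ⟨Y, hY, rfl⟩
    refine ⟨X * Y - Y * X, hbr X hX Y hY, ?_⟩
    rw [hr_apply, hr_apply, hr_apply, ← restrict_mul ι₀ π₀ hπι₀ (h𝔞 hY), ← restrict_mul ι₀ π₀ hπι₀ (h𝔞 hX)]
    refine LinearMap.ext fun v => ?_
    simp only [LinearMap.comp_apply, LinearMap.sub_apply, Module.End.mul_apply, map_sub]
  have hfull : H'.hodgeLie ≤ 𝔞.map r :=
    hrig' _ hle hbr' ⟨_, restrict_mem_spanC_map ι₀ π₀ 𝔞 hΘ𝔞, restrict_theta_apply ι₀ π₀ hπι₀ Θ hΘ⟩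
  -- dimensions
  have hdim : Module.finrank ℚ H.hodgeLie ≤ Module.finrank ℚ 𝔞 :=
    calc Module.finrank ℚ H.hodgeLie = Module.finrank ℚ H'.hodgeLie :=
          finrank_hodgeLie_eq_of_duplicate_summand ι₁' π₁' ι₂' π₂' hπι₁' hπι₂' hsum' ι₀ π₀ ι₃ π₃ hπι₀ hπι₃ hsum
      _ ≤ Module.finrank ℚ ↥(𝔞.map r) := Submodule.finrank_mono hfull
      _ ≤ Module.finrank ℚ 𝔞 := Submodule.finrank_map_le _ _
  exact (Submodule.eq_of_le_of_finrank_le h𝔞 hdim).ge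

end HodgeStructure

end Literature.AlgebraicGeometry.Motives

end
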